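/-
Copyright (c) 2026 the pub-hodgecm-mathlib formalisation cell (harness21).  Prover seat hodgecm-mathlib-K2E3-p24 (g0), Track B «K2-LIT» ∕ h413
(`stmt-HodgeConjecture-24833`), line `K2_E3_EllipticInputs`, road «GL₂-sc» (hosted socket `sig_K2E3GL2SupercuspidalCharLocInt`, U12 :520; road owner K2E5-p17 (g5)),
brick (2E-b1): the compact-centraliser and the finite-fibre forms of (FC) on `Ḡ = GL₂(F) ⧸ Z`, from the ADMISSIBLE master form (hypothesis-first).  2026-09-04.
-/
import Summits.HodgeConjecture.HodgeConjecture.Theorems.K2E3GL2ModCentreUnimodular     -- ★ (2F-a′) p858754 (K2E5-p17 g5): `isMulRightInvariant_quot_of_isHaarMeasure`; brings ★ (2F-a) frame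
import Summits.HodgeConjecture.HodgeConjecture.Theorems.K2E3FinConjFibreReduction        -- ★ (F2) `fibre_subset_compactCentralizer`
import HarnessLib

/-!
# Road «GL₂-sc», brick (2E-b1) — `(FC)` on `Ḡ = GL₂(F) ⧸ Z` over the COMPACT-CENTRALISER domain and over the FINITE-FIBRE domain, from the admissible master form

Cell `pub/hodgecm-mathlib` (D-0151), Track B, seat K2E3-p24 (g0) = hand BY NAME on road «GL₂-sc» (road owner K2E5-p17 (g5), ASSIGNMENTS 2026-09-04T09:19:45Z:
«(2E-b1) `K2E3GL2FinConjAdmissible` ← ★ B1⁰ `K2E3GL3FinConjAdmissible.finConjGL_cc`, HYPOTHESIS-FIRST on the 2E-a5 head»).  `--supports stmt-HodgeConjecture-24833 --as helper`;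
THEOREMS ONLY (no definition ∕ instance ∕ notation ∕ named fact ∕ `sorry`); never imports `Cruxes/…/Lines`.  COUNT-NEUTRAL.

THE MATHEMATICS ([HarishChandra1970, Part VII §2]; [Cartier1979, §IV.1]).  Let `W(ḡ) = ∫_Ḡ β(x̄ ḡ x̄⁻¹) dμ̄` be the conjugation fibre of a bounded continuous compactly
supported `β ≥ 0` on `Ḡ = GL₂(F) ⧸ Z`.  The MASTER (admissible) form of Harish-Chandra's finiteness — brick (2E-a5), the `N = 2` twin of ★ B1⁰
`K2E3GL3FinConjAdmissible.finConjGL_of_admissible` (one-parameter Cartan cover, normalised boxes ★ (2E-a1), Hensel ★ (2E-a3), torus averaging ★ (2E-a4), ★ F3a‴) —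
says `∫⁻_A W dμ̄ < ⊤` for every `A ⊆ C` (`C` compact) all of whose elements whose orbit meets `{β ≠ 0}` have compact centraliser.  It is carried here as the binder
`hFC` (so this file runs in parallel with 2E-a5).  Two specialisations:
* **`finConjGL_cc`** — `A = C ∩ {Z_Ḡ(ḡ) compact}` (trivially admissible): the form consumed by the central-quotient transfer (2E-b2) and the elliptic package (2E-c),
  exactly as ★ B1⁰ :324 at `N = 3`;
* **`finConjGL`** — `A = C ∩ {W(ḡ) < ⊤}`, admissible by ★ (F2) `fibre_subset_compactCentralizer` (a finite fibre through `{β ≠ 0}` forces a compact centraliser): the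
  `N = 2` twin of ★ GL-3b `K2E3GL3FinConj.finConjGL`'s statement.
So at `N = 2` ONE analytic body (2E-a5) serves all three statements (at `N = 3` the body was typed twice, GL-3b and B1⁰).

HONEST LABEL: HC_CM is proved only modulo the 7 printed citations (2 remaining named inputs: hLiu418 = stmt-HodgeConjecture-24832, h413 =
stmt-HodgeConjecture-24833) until rung 0 closes; count-neutral helper; CONDITIONAL on the binder `hFC` (brick (2E-a5), K2E3-p17 (g8)).

## References
* [HarishChandra1970] Harish-Chandra (notes by G. van Dijk), *Harmonic Analysis on Reductive p-adic Groups*, LNM 162 (1970), Part VII §2 p. 69.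
* [Cartier1979] P. Cartier, *Representations of 𝔭-adic groups: a survey*, PSPM 33.1 (1979), §IV.1.
-/

set_option autoImplicit false
set_option linter.dupNamespace false

noncomputable section

open MeasureTheory MeasureTheory.Measure Set Function
open scoped NNReal ENNReal MatrixGroups WithZero Valued Topology

namespace Summit.HodgeConjecture.HodgeConjecture.Cruxes.H413.K2E3GL2FinConjAdmissible

open Literature.NumberTheory.Automorphic
open Summit.HodgeConjecture.HodgeConjecture.Cruxes.H413.K2E3GL2ModCentre
open Summit.HodgeConjecture.HodgeConjecture.Cruxes.H413.K2E3FinConjFibreReduction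

variable {F : Type*} [Field F] [Valued F ℤᵐ⁰] [ValuativeRel F] [(Valued.v : Valuation F ℤᵐ⁰).Compatible] [IsNonarchimedeanLocalField F] [CharZero F]

omit [ValuativeRel F] [(Valued.v : Valuation F ℤᵐ⁰).Compatible] [IsNonarchimedeanLocalField F] [CharZero F] in
/-- **(FC) on `Ḡ = GL₂(F) ⧸ Z`, COMPACT-CENTRALISER DOMAIN** — `∫⁻_{C ∩ {Z_Ḡ(ḡ) compact}} ∫⁻ β(x̄ ḡ x̄⁻¹) dμ̄ dμ̄ < ⊤`, from the admissible master form `hFC` (brick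
(2E-a5)) at `A = C ∩ {Z compact}` (the `N = 2` twin of ★ B1⁰ `finConjGL_cc`). [cite: HarishChandra1970, Part VII §2 p. 69] [cite: Cartier1979, §IV.1] -/
theorem finConjGL_cc
    [MeasurableSpace (GL (Fin 2) F ⧸ Subgroup.center (GL (Fin 2) F))] [BorelSpace (GL (Fin 2) F ⧸ Subgroup.center (GL (Fin 2) F))]
    (μ : Measure (GL (Fin 2) F ⧸ Subgroup.center (GL (Fin 2) F))) [μ.IsHaarMeasure]
    (hFC : ∀ {C : Set (GL (Fin 2) F ⧸ Subgroup.center (GL (Fin 2) F))}, IsCompact C →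
      ∀ {β : (GL (Fin 2) F ⧸ Subgroup.center (GL (Fin 2) F)) → ℝ≥0∞}, Continuous β → IsCompact (tsupport β) →
      ∀ {Mb : ℝ≥0∞}, Mb ≠ ⊤ → (∀ g, β g ≤ Mb) →
      ∀ {A : Set (GL (Fin 2) F ⧸ Subgroup.center (GL (Fin 2) F))}, A ⊆ C →
      (∀ x : GL (Fin 2) F ⧸ Subgroup.center (GL (Fin 2) F), ∀ g ∈ A, x * g * x⁻¹ ∈ {u : GL (Fin 2) F ⧸ Subgroup.center (GL (Fin 2) F) | β u ≠ 0} →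
        g ∈ {h : GL (Fin 2) F ⧸ Subgroup.center (GL (Fin 2) F) | IsCompact ((Subgroup.centralizer ({h} : Set (GL (Fin 2) F ⧸ Subgroup.center (GL (Fin 2) F)))) :
          Set (GL (Fin 2) F ⧸ Subgroup.center (GL (Fin 2) F)))}) →
      ∫⁻ g in A, ∫⁻ x, β (x * g * x⁻¹) ∂μ ∂μ < ⊤)
    {C : Set (GL (Fin 2) F ⧸ Subgroup.center (GL (Fin 2) F))} (hC : IsCompact C)
    {β : (GL (Fin 2) F ⧸ Subgroup.center (GL (Fin 2) F)) → ℝ≥0∞} (hβ : Continuous β) (hβs : IsCompact (tsupport β))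
    {Mb : ℝ≥0∞} (hMb : Mb ≠ ⊤) (hβM : ∀ g, β g ≤ Mb) :
    ∫⁻ g in C ∩ {h : GL (Fin 2) F ⧸ Subgroup.center (GL (Fin 2) F) | IsCompact ((Subgroup.centralizer ({h} : Set (GL (Fin 2) F ⧸ Subgroup.center (GL (Fin 2) F)))) :
        Set (GL (Fin 2) F ⧸ Subgroup.center (GL (Fin 2) F)))}, ∫⁻ x, β (x * g * x⁻¹) ∂μ ∂μ < ⊤ := by
  exact hFC hC hβ hβs hMb hβM Set.inter_subset_left (fun _ _ hg _ => hg.2)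

omit [CharZero F] in
/-- **(FC) on `Ḡ = GL₂(F) ⧸ Z`, FINITE-FIBRE DOMAIN** — `∫⁻_{C ∩ {W(ḡ) < ⊤}} W dμ̄ < ⊤` (the `N = 2` twin of ★ GL-3b `finConjGL`'s statement): the domain is admissible by
★ (F2) `fibre_subset_compactCentralizer` (Haar measures on `Ḡ` are right invariant, ★ (2F-a′)). [cite: HarishChandra1970, Part VII §2 p. 69] [cite: Cartier1979, §IV.1] -/
theorem finConjGL {ϖ : F} (hϖ : Valued.v ϖ = WithZero.exp (-1 : ℤ))
    [MeasurableSpace (GL (Fin 2) F ⧸ Subgroup.center (GL (Fin 2) F))] [BorelSpace (GL (Fin 2) F ⧸ Subgroup.center (GL (Fin 2) F))]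
    (μ : Measure (GL (Fin 2) F ⧸ Subgroup.center (GL (Fin 2) F))) [μ.IsHaarMeasure]
    (hFC : ∀ {C : Set (GL (Fin 2) F ⧸ Subgroup.center (GL (Fin 2) F))}, IsCompact C →
      ∀ {β : (GL (Fin 2) F ⧸ Subgroup.center (GL (Fin 2) F)) → ℝ≥0∞}, Continuous β → IsCompact (tsupport β) →
      ∀ {Mb : ℝ≥0∞}, Mb ≠ ⊤ → (∀ g, β g ≤ Mb) →
      ∀ {A : Set (GL (Fin 2) F ⧸ Subgroup.center (GL (Fin 2) F))}, A ⊆ C →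
      (∀ x : GL (Fin 2) F ⧸ Subgroup.center (GL (Fin 2) F), ∀ g ∈ A, x * g * x⁻¹ ∈ {u : GL (Fin 2) F ⧸ Subgroup.center (GL (Fin 2) F) | β u ≠ 0} →
        g ∈ {h : GL (Fin 2) F ⧸ Subgroup.center (GL (Fin 2) F) | IsCompact ((Subgroup.centralizer ({h} : Set (GL (Fin 2) F ⧸ Subgroup.center (GL (Fin 2) F)))) :
          Set (GL (Fin 2) F ⧸ Subgroup.center (GL (Fin 2) F)))}) →
      ∫⁻ g in A, ∫⁻ x, β (x * g * x⁻¹) ∂μ ∂μ < ⊤)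
    {C : Set (GL (Fin 2) F ⧸ Subgroup.center (GL (Fin 2) F))} (hC : IsCompact C)
    {β : (GL (Fin 2) F ⧸ Subgroup.center (GL (Fin 2) F)) → ℝ≥0∞} (hβ : Continuous β) (hβs : IsCompact (tsupport β))
    {Mb : ℝ≥0∞} (hMb : Mb ≠ ⊤) (hβM : ∀ g, β g ≤ Mb) :
    ∫⁻ g in C ∩ {g : GL (Fin 2) F ⧸ Subgroup.center (GL (Fin 2) F) | ∫⁻ x, β (x * g * x⁻¹) ∂μ < ⊤}, ∫⁻ x, β (x * g * x⁻¹) ∂μ ∂μ < ⊤ := by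
  haveI : SecondCountableTopology (GL (Fin 2) F) := secondCountableTopology_gl2 F
  haveI : LocallyCompactSpace (GL (Fin 2) F) := locallyCompactSpace_gl2 F
  haveI : T2Space (GL (Fin 2) F ⧸ Subgroup.center (GL (Fin 2) F)) := t2Space_quot F
  haveI : μ.IsMulRightInvariant := K2E3GL2ModCentreUnimodular.isMulRightInvariant_quot_of_isHaarMeasure hϖ μ
  exact hFC hC hβ hβs hMb hβM Set.inter_subset_left (fibre_subset_compactCentralizer μ hβ Set.inter_subset_right)

end Summit.HodgeConjecture.HodgeConjecture.Cruxes.H413.K2E3GL2FinConjAdmissible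

end
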